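import Mathlib.Tactic.Group
import Literature.AnabelianGeometry.SemiGraphs.Temperoids
import HarnessLib

/-!
# Semi-graphs of anabelioids, §3: proofs of Corollary 3.3 and of the injectivity half of
# Proposition 3.2 ("in particular")

Mochizuki, *Semi-graphs of anabelioids*, Publ. RIMS **42** (2006), §3, manuscript p. 35
[cite: MochizukiSemiAnbd2006, Prop 3.2 p.35]: "there is a natural bijective correspondence between
the set of isomorphism classes of morphisms `T₁ → T₂` and the set of [continuous] outer
homomorphisms `Π₁ → Π₂`" (Proposition 3.2, "in particular"), and Corollary 3.3 "`B^temp(φ)` is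
rigid if and only if the centralizer `Z_{Π₂}(Im(φ))` is trivial".  PROOF-ONLY companion of
`Temperoids.lean` (abc-iut-L3-t2): the named facts `ResIsoResIff` (the injectivity half of the "in
particular": `B^temp(φ) ≅ B^temp(ψ) ⟺ ψ = γ_g ∘ φ`) and `RigidIffCentralizerTrivial` (Cor. 3.3) are
DISCHARGED; no new `def … : Prop`.

Proof (the printed "[cf. [Mzk4], Proposition 1.1.4 / Corollary 1.1.6]", spelled out for
`B^temp(Π)`).  (1) If `ψ = γ_g ∘ φ`, acting by `g` on every `Π₂`-set is a natural isomorphism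
`B^temp(φ) ≅ B^temp(ψ)`.  (2) Conversely — Yoneda on the Galois objects `Π₂/N`, `N` open normal
(objects of `B^temp(Π₂)` by Remark 3.1.2): a natural transformation `η : B^temp(φ) ⟶ B^temp(ψ)` acts
on `Π₂/N` as left multiplication by `a_N := η(N)` (naturality along right multiplications), the
`a_N` are compatible (naturality along the projections `Π₂/N → Π₂/M`), so they come from one
`g ∈ Π₂` (`Π₂` is tempered: the "complete" clause of Definition 3.1 (i)); equivariance of `η` on
`Π₂/N` for all `N` and the "separated" clause give `ψ = γ_g ∘ φ`; and `η` acts as `g` on EVERY object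
(orbit maps `Π₂/N → X`, `N` an open normal subgroup inside the open stabiliser — the "basis"
clause).  (3) Cor. 3.3: an automorphism of `B^temp(φ)` is the action of a `g` centralising `Im(φ)`,
and such a `g` acts trivially on all `Π₂/N` only if `g = 1`.  The Galois-countability hypotheses of
the typed statements ([IUTchI] Rmk. 2.5.3 (E7)) are carried and not used.  Nothing here takes a
side on [IUTchIII] Cor. 3.12.
-/

namespace Literature.AnabelianGeometry.SemiGraphs

open CategoryTheory Topology

open Literature.AlgebraicGeometry.Frobenioids (IsRigidFunctor)

universe u

namespace BTemp

/-! ### Bookkeeping for `Π`-sets -/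

section Actions

variable {G : Type u} [Group G]

/-- The action `ρ` of a `Π`-set is multiplicative on elements: `ρ (g h) x = ρ g (ρ h x)`. [folklore] -/
private theorem ρ_mul_apply (X : Action (Type u) G) (g h : G) (x : X.V) :
    X.ρ (g * h) x = X.ρ g (X.ρ h x) := by
  rw [map_mul]; rfl

/-- `ρ 1 = id` on elements. [folklore] -/
private theorem ρ_one_apply (X : Action (Type u) G) (x : X.V) : X.ρ 1 x = x := by
  rw [map_one]; rfl

/-- Equivariance of a morphism of `Π`-sets on elements. [folklore] -/
private theorem hom_apply_ρ {X Y : Action (Type u) G} (f : X ⟶ Y) (g : G) (x : X.V) :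
    f.hom (X.ρ g x) = Y.ρ g (f.hom x) := by
  have h := congrArg (fun t => t x) (f.comm g)
  simpa [types_comp_apply] using h

end Actions

variable {G₁ : Type u} [Group G₁] [TopologicalSpace G₁] {G₂ : Type u} [Group G₂]
  [TopologicalSpace G₂]

/-! ### Bookkeeping for `B^temp(Π)` as a full subcategory of `Π`-sets -/

/-- The underlying `Π₁`-set of `B^temp(φ)(X)` is the underlying set of `X` with `Π₁` acting through
`φ`. [cite: MochizukiSemiAnbd2006, Rmk 3.1.2 pp.33-34] -/
theorem res_obj_ρ_apply (φ : G₁ →ₜ* G₂) (X : BTemp G₂) (a : G₁) (x : X.obj.V) :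
    ((BTemp.res φ).obj X).obj.ρ a x = X.obj.ρ (φ a) x := rfl

/-- The underlying map of `B^temp(φ)(f)` is that of `f`. [cite: MochizukiSemiAnbd2006, Rmk 3.1.2 pp.33-34] -/
theorem res_map_hom_hom (φ : G₁ →ₜ* G₂) {X Y : BTemp G₂} (f : X ⟶ Y) :
    ((BTemp.res φ).map f).hom.hom = f.hom.hom := rfl

/-- A morphism of `B^temp(Π)` built from an equivariant map of underlying sets.
[cite: MochizukiSemiAnbd2006, §3 p.33] -/
def homOfEquivariant (X Y : BTemp G₂) (f : X.obj.V → Y.obj.V)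
    (hf : ∀ (g : G₂) (x : X.obj.V), f (X.obj.ρ g x) = Y.obj.ρ g (f x)) : X ⟶ Y :=
  ObjectProperty.homMk
    { hom := TypeCat.ofHom f
      comm := fun g => ConcreteCategory.hom_ext _ _ fun x => by
        simp only [types_comp_apply, TypeCat.ofHom_apply, hf] }

/-- Underlying map of `homOfEquivariant`. [cite: MochizukiSemiAnbd2006, §3 p.33] -/
@[simp] theorem homOfEquivariant_apply (X Y : BTemp G₂) (f : X.obj.V → Y.obj.V)
    (hf : ∀ (g : G₂) (x : X.obj.V), f (X.obj.ρ g x) = Y.obj.ρ g (f x)) (x : X.obj.V) :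
    (homOfEquivariant X Y f hf).hom.hom x = f x := rfl

/-- Naturality of a transformation `η : B^temp(φ) ⟶ B^temp(ψ)` on elements.
[cite: MochizukiSemiAnbd2006, Prop 3.2 p.35] -/
theorem naturality_apply {φ ψ : G₁ →ₜ* G₂} (η : BTemp.res φ ⟶ BTemp.res ψ) {X Y : BTemp G₂}
    (f : X ⟶ Y) (x : X.obj.V) :
    (η.app Y).hom.hom (f.hom.hom x) = f.hom.hom ((η.app X).hom.hom x) := by
  have h := congrArg (fun t => t.hom.hom x) (η.naturality f)
  simp only [ObjectProperty.FullSubcategory.comp_hom, Action.comp_hom, types_comp_apply,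
    res_map_hom_hom] at h
  exact h

/-- Equivariance of a component of `η : B^temp(φ) ⟶ B^temp(ψ)` on elements:
`η(φ(a) · x) = ψ(a) · η(x)`. [cite: MochizukiSemiAnbd2006, Prop 3.2 p.35] -/
theorem app_equivariant {φ ψ : G₁ →ₜ* G₂} (η : BTemp.res φ ⟶ BTemp.res ψ) (X : BTemp G₂)
    (a : G₁) (x : X.obj.V) :
    (η.app X).hom.hom (X.obj.ρ (φ a) x) = X.obj.ρ (ψ a) ((η.app X).hom.hom x) :=
  hom_apply_ρ (η.app X).hom a x

/-! ### (1) Conjugate homomorphisms give isomorphic pull-back functors -/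

/-- If `ψ = γ_g ∘ φ`, acting by `g` is a natural isomorphism `B^temp(φ) ≅ B^temp(ψ)` (the easy
half of [SemiAnbd] Prop. 3.2 "in particular", p. 35). [cite: MochizukiSemiAnbd2006, Prop 3.2 p.35] -/
def resIsoOfConj (φ ψ : G₁ →ₜ* G₂) (g : G₂) (hg : ∀ a : G₁, g * φ a * g⁻¹ = ψ a) :
    BTemp.res φ ≅ BTemp.res ψ :=
  NatIso.ofComponents
    (fun X =>
      { hom := homOfEquivariant ((BTemp.res φ).obj X) ((BTemp.res ψ).obj X)
          (fun x => X.obj.ρ g x) (fun a x => by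
            change X.obj.ρ g (X.obj.ρ (φ a) x) = X.obj.ρ (ψ a) (X.obj.ρ g x)
            rw [← ρ_mul_apply, ← ρ_mul_apply, ← hg a, inv_mul_cancel_right])
        inv := homOfEquivariant ((BTemp.res ψ).obj X) ((BTemp.res φ).obj X)
          (fun x => X.obj.ρ g⁻¹ x) (fun a x => by
            change X.obj.ρ g⁻¹ (X.obj.ρ (ψ a) x) = X.obj.ρ (φ a) (X.obj.ρ g⁻¹ x)
            rw [← ρ_mul_apply, ← ρ_mul_apply, ← hg a]
            congr 1
            group)
        hom_inv_id := by
          apply ObjectProperty.hom_ext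
          apply Action.Hom.ext
          refine ConcreteCategory.hom_ext _ _ fun x => ?_
          change X.obj.ρ g⁻¹ (X.obj.ρ g x) = x
          rw [← ρ_mul_apply, inv_mul_cancel, ρ_one_apply]
        inv_hom_id := by
          apply ObjectProperty.hom_ext
          apply Action.Hom.ext
          refine ConcreteCategory.hom_ext _ _ fun x => ?_
          change X.obj.ρ g (X.obj.ρ g⁻¹ x) = x
          rw [← ρ_mul_apply, mul_inv_cancel, ρ_one_apply] })
    (fun {X Y} f => by
      apply ObjectProperty.hom_ext
      apply Action.Hom.ext
      refine ConcreteCategory.hom_ext _ _ fun x => ?_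
      change Y.obj.ρ g (f.hom.hom x) = f.hom.hom (X.obj.ρ g x)
      exact (hom_apply_ρ f.hom g x).symm)

/-- On elements, `resIsoOfConj φ ψ g hg` acts by `g`. [cite: MochizukiSemiAnbd2006, Prop 3.2 p.35] -/
theorem resIsoOfConj_hom_app_apply (φ ψ : G₁ →ₜ* G₂) (g : G₂)
    (hg : ∀ a : G₁, g * φ a * g⁻¹ = ψ a) (X : BTemp G₂) (x : X.obj.V) :
    ((resIsoOfConj φ ψ g hg).hom.app X).hom.hom x = X.obj.ρ g x := rfl

/-! ### (2) Natural transformations come from elements of `Π₂` (Yoneda on the `Π₂/N`) -/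

section Tempered

variable [IsTopologicalGroup G₂] (hG : IsTempered G₂)

/-- The Galois object `Π₂/N` of `B^temp(Π₂)` for an open normal subgroup `N` (Remark 3.1.2 / 3.1.3).
[cite: MochizukiSemiAnbd2006, Rmk 3.1.3 p.34] -/
abbrev Q (N : OpenNormalSubgroup G₂) : BTemp G₂ :=
  BTemp.quotientObj G₂ hG N.toSubgroup N.isOpen'

/-- The action on `Π₂/N` is left multiplication. [cite: MochizukiSemiAnbd2006, Rmk 3.1.2 p.33] -/
theorem Q_ρ_apply (N : OpenNormalSubgroup G₂) (g y : G₂) :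
    (Q hG N).obj.ρ g (y : G₂ ⧸ N.toSubgroup) = ((g * y : G₂) : G₂ ⧸ N.toSubgroup) := by
  change g • (y : G₂ ⧸ N.toSubgroup) = _
  rw [MulAction.Quotient.smul_coe, smul_eq_mul]

/-- Right multiplication by `y` on `Π₂/N`, a `Π₂`-endomorphism of the Galois object `Π₂/N`.
[cite: MochizukiSemiAnbd2006, Rmk 3.1.2 p.33] -/
def rightMul (N : OpenNormalSubgroup G₂) (y : G₂) : Q hG N ⟶ Q hG N :=
  homOfEquivariant (Q hG N) (Q hG N)
    (fun q : G₂ ⧸ N.toSubgroup => q * (y : G₂ ⧸ N.toSubgroup)) (by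
      intro g q
      obtain ⟨z, rfl⟩ := QuotientGroup.mk_surjective q
      rw [Q_ρ_apply, ← QuotientGroup.mk_mul, ← QuotientGroup.mk_mul, Q_ρ_apply, mul_assoc])

/-- Value of `rightMul` on a coset. [cite: MochizukiSemiAnbd2006, Rmk 3.1.2 p.33] -/
theorem rightMul_apply (N : OpenNormalSubgroup G₂) (y z : G₂) :
    (rightMul hG N y).hom.hom (z : G₂ ⧸ N.toSubgroup) = ((z * y : G₂) : G₂ ⧸ N.toSubgroup) := by
  rw [rightMul, homOfEquivariant_apply, QuotientGroup.mk_mul]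

/-- The projection `Π₂/N → Π₂/M` for `N ≤ M`, a `Π₂`-morphism of Galois objects.
[cite: MochizukiSemiAnbd2006, Rmk 3.1.2 p.33] -/
def proj {N M : OpenNormalSubgroup G₂} (h : N ≤ M) : Q hG N ⟶ Q hG M :=
  homOfEquivariant (Q hG N) (Q hG M)
    (fun q : G₂ ⧸ N.toSubgroup =>
      QuotientGroup.map N.toSubgroup M.toSubgroup (MonoidHom.id G₂) (fun x hx => h hx) q) (by
      intro g q
      obtain ⟨z, rfl⟩ := QuotientGroup.mk_surjective q
      rw [Q_ρ_apply, QuotientGroup.map_mk, QuotientGroup.map_mk, MonoidHom.id_apply,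
        MonoidHom.id_apply, Q_ρ_apply])

/-- Value of `proj` on a coset. [cite: MochizukiSemiAnbd2006, Rmk 3.1.2 p.33] -/
theorem proj_apply {N M : OpenNormalSubgroup G₂} (h : N ≤ M) (z : G₂) :
    (proj hG h).hom.hom (z : G₂ ⧸ N.toSubgroup) = (z : G₂ ⧸ M.toSubgroup) := by
  rw [proj, homOfEquivariant_apply, QuotientGroup.map_mk, MonoidHom.id_apply]

/-- The subgroup of elements of `Π₂` fixing a point `x` of an object of `B^temp(Π₂)`; it is open.
[cite: MochizukiSemiAnbd2006, §3 p.33] -/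
def stab (X : BTemp G₂) (x : X.obj.V) : Subgroup G₂ where
  carrier := {g | X.obj.ρ g x = x}
  one_mem' := ρ_one_apply X.obj x
  mul_mem' {g h} hg hh := by
    change X.obj.ρ (g * h) x = x
    rw [ρ_mul_apply, show X.obj.ρ h x = x from hh, show X.obj.ρ g x = x from hg]
  inv_mem' {g} hg := by
    change X.obj.ρ g⁻¹ x = x
    conv_lhs => rw [← show X.obj.ρ g x = x from hg]
    rw [← ρ_mul_apply, inv_mul_cancel, ρ_one_apply]

/-- The orbit map `Π₂/N → X`, `gN ↦ g · x`, for an open normal subgroup `N` fixing `x`: a morphism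
of `B^temp(Π₂)`. [cite: MochizukiSemiAnbd2006, Rmk 3.1.2 p.33] -/
def orbitMap (X : BTemp G₂) (x : X.obj.V) (N : OpenNormalSubgroup G₂)
    (hN : N.toSubgroup ≤ stab X x) : Q hG N ⟶ X :=
  homOfEquivariant (Q hG N) X
    (fun q : G₂ ⧸ N.toSubgroup => Quotient.liftOn' q (fun g => X.obj.ρ g x) (by
      intro a b hab
      rw [QuotientGroup.leftRel_apply] at hab
      have hfix : X.obj.ρ (a⁻¹ * b) x = x := hN hab
      change X.obj.ρ a x = X.obj.ρ b x
      conv_lhs => rw [← hfix]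
      rw [← ρ_mul_apply, mul_inv_cancel_left]))
    (by
      intro g q
      obtain ⟨z, rfl⟩ := QuotientGroup.mk_surjective q
      rw [Q_ρ_apply]
      change X.obj.ρ (g * z) x = X.obj.ρ g (X.obj.ρ z x)
      rw [ρ_mul_apply])

/-- Value of the orbit map on a coset. [cite: MochizukiSemiAnbd2006, Rmk 3.1.2 p.33] -/
theorem orbitMap_apply (X : BTemp G₂) (x : X.obj.V) (N : OpenNormalSubgroup G₂)
    (hN : N.toSubgroup ≤ stab X x) (g : G₂) :
    (orbitMap hG X x N hN).hom.hom (g : G₂ ⧸ N.toSubgroup) = X.obj.ρ g x := rfl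

/-- **The key lemma** (Yoneda on the Galois objects, for `Π₂` tempered): every natural transformation
`η : B^temp(φ) ⟶ B^temp(ψ)` is the action of a single `g ∈ Π₂` with `ψ = γ_g ∘ φ`.
[cite: MochizukiSemiAnbd2006, Prop 3.2 p.35] -/
theorem exists_conj_of_natTrans (hG : IsTempered G₂) (φ ψ : G₁ →ₜ* G₂)
    (η : BTemp.res φ ⟶ BTemp.res ψ) :
    ∃ g : G₂, (∀ a : G₁, g * φ a * g⁻¹ = ψ a) ∧
      ∀ (X : BTemp G₂) (x : X.obj.V), (η.app X).hom.hom x = X.obj.ρ g x := by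
  -- `a_N := η(N) ∈ Π₂/N`
  set a : (N : OpenNormalSubgroup G₂) → G₂ ⧸ N.toSubgroup :=
    fun N => (η.app (Q hG N)).hom.hom ((1 : G₂) : G₂ ⧸ N.toSubgroup) with ha
  -- `η` acts on `Π₂/N` as left multiplication by `a_N`
  have hmul : ∀ (N : OpenNormalSubgroup G₂) (y : G₂),
      (η.app (Q hG N)).hom.hom (y : G₂ ⧸ N.toSubgroup) = a N * (y : G₂ ⧸ N.toSubgroup) := by
    intro N y
    have h := naturality_apply η (rightMul hG N y) ((1 : G₂) : G₂ ⧸ N.toSubgroup)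
    rw [rightMul_apply, one_mul] at h
    rw [h]
    -- the right-hand side is `rightMul y (a N)`
    obtain ⟨w, hw⟩ := QuotientGroup.mk_surjective (a N)
    change (rightMul hG N y).hom.hom (a N) = a N * (y : G₂ ⧸ N.toSubgroup)
    rw [← hw, rightMul_apply, QuotientGroup.mk_mul]
  -- compatibility of the `a_N`
  have hcompat : ∀ N M : OpenNormalSubgroup G₂, N ≤ M → ∀ g : G₂,
      a N = (g : G₂ ⧸ N.toSubgroup) → a M = (g : G₂ ⧸ M.toSubgroup) := by
    intro N M hNM g hgN
    have h := naturality_apply η (proj hG hNM) ((1 : G₂) : G₂ ⧸ N.toSubgroup)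
    rw [proj_apply] at h
    change a M = (proj hG hNM).hom.hom (a N) at h
    rw [h, hgN, proj_apply]
  obtain ⟨g, hg⟩ := hG.complete a hcompat
  -- `η` is the action of `g` on every object
  have hact : ∀ (X : BTemp G₂) (x : X.obj.V), (η.app X).hom.hom x = X.obj.ρ g x := by
    intro X x
    have hopen : IsOpen ((stab X x : Subgroup G₂) : Set G₂) := X.property.2 x
    obtain ⟨N, -, hNsub⟩ := hG.basis _ (hopen.mem_nhds (stab X x).one_mem)
    have hN : N.toSubgroup ≤ stab X x := fun y hy => hNsub hy
    have h := naturality_apply η (orbitMap hG X x N hN) ((1 : G₂) : G₂ ⧸ N.toSubgroup)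
    rw [orbitMap_apply, ρ_one_apply] at h
    rw [h]
    change (orbitMap hG X x N hN).hom.hom (a N) = _
    rw [hg N, orbitMap_apply]
  refine ⟨g, fun b => ?_, hact⟩
  -- equivariance on the `Π₂/N` + separatedness give `ψ = γ_g ∘ φ`
  by_contra hne
  have hne' : (g * φ b)⁻¹ * (ψ b * g) ≠ 1 := by
    intro h1
    apply hne
    have h2 : ψ b * g = g * φ b := by
      rw [← mul_inv_cancel_left (g * φ b) (ψ b * g), h1, mul_one]
    rw [← h2, mul_inv_cancel_right]
  obtain ⟨N, hN⟩ := hG.separated _ hne'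
  apply hN
  have h := app_equivariant η (Q hG N) b ((1 : G₂) : G₂ ⧸ N.toSubgroup)
  rw [Q_ρ_apply, mul_one, hmul, hmul, hg N, ← QuotientGroup.mk_mul, ← QuotientGroup.mk_mul,
    mul_one, Q_ρ_apply] at h
  have h' : ((g * φ b : G₂) : G₂ ⧸ N.toSubgroup) = ((ψ b * g : G₂) : G₂ ⧸ N.toSubgroup) := h
  exact QuotientGroup.eq.mp h'

end Tempered

end BTemp

/-! ### (3) The named facts -/

/-- **[SemiAnbd] Proposition 3.2, "in particular" (injectivity half)** — DISCHARGE of the named fact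
`ResIsoResIff` of `Temperoids.lean`: `B^temp(φ) ≅ B^temp(ψ)` if and only if `ψ = γ_g ∘ φ` for some
`g ∈ Π₂`. [cite: MochizukiSemiAnbd2006, Prop 3.2 p.35] -/
theorem ResIsoResIff_holds :
    ∀ (G₁ : Type u) [Group G₁] [TopologicalSpace G₁] (G₂ : Type u) [Group G₂]
      [TopologicalSpace G₂], ResIsoResIff G₁ G₂ := by
  intro G₁ _ _ G₂ _ _ _ _ _ _ _ hG₂ φ ψ
  constructor
  · rintro ⟨e⟩
    obtain ⟨g, hg, -⟩ := BTemp.exists_conj_of_natTrans hG₂ φ ψ e.hom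
    exact ⟨g, hg⟩
  · rintro ⟨g, hg⟩
    exact ⟨BTemp.resIsoOfConj φ ψ g hg⟩

/-- **[SemiAnbd] Corollary 3.3 (Rigid Morphisms of Connected Temperoids)** — DISCHARGE of the named
fact `RigidIffCentralizerTrivial` of `Temperoids.lean`: "`B^temp(φ)` is rigid if and only if the
centralizer `Z_{Π₂}(Im(φ))` is trivial." [cite: MochizukiSemiAnbd2006, Cor 3.3 p.35] -/
theorem RigidIffCentralizerTrivial_holds :
    ∀ (G₁ : Type u) [Group G₁] [TopologicalSpace G₁] (G₂ : Type u) [Group G₂]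
      [TopologicalSpace G₂], RigidIffCentralizerTrivial G₁ G₂ := by
  intro G₁ _ _ G₂ _ _ _ _ _ _ _ hG₂ φ
  constructor
  · -- rigid ⇒ centralizer trivial
    intro hrig
    rw [Subgroup.eq_bot_iff_forall]
    intro z hz
    rw [Subgroup.mem_centralizer_iff] at hz
    have hconj : ∀ a : G₁, z * φ a * z⁻¹ = φ a := fun a => by
      rw [← hz (φ a) ⟨a, rfl⟩, mul_inv_cancel_right]
    have hid := hrig (BTemp.resIsoOfConj φ φ z hconj)
    -- so `z` acts trivially on every `Π₂/N`, hence lies in every open normal subgroup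
    by_contra hz1
    obtain ⟨N, hN⟩ := hG₂.separated z hz1
    apply hN
    have h := congrArg (fun e : BTemp.res φ ≅ BTemp.res φ =>
      (e.hom.app (BTemp.Q hG₂ N)).hom.hom ((1 : G₂) : G₂ ⧸ N.toSubgroup)) hid
    change (BTemp.Q hG₂ N).obj.ρ z ((1 : G₂) : G₂ ⧸ N.toSubgroup) =
      ((1 : G₂) : G₂ ⧸ N.toSubgroup) at h
    rw [BTemp.Q_ρ_apply, mul_one] at h
    have h' : ((z : G₂) : G₂ ⧸ N.toSubgroup) = ((1 : G₂) : G₂ ⧸ N.toSubgroup) := h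
    rw [QuotientGroup.eq, mul_one] at h'
    exact (Subgroup.inv_mem_iff _).mp h'
  · -- centralizer trivial ⇒ rigid
    intro hcent α
    obtain ⟨g, hg, hact⟩ := BTemp.exists_conj_of_natTrans hG₂ φ φ α.hom
    have hgz : g ∈ Subgroup.centralizer (Set.range φ : Set G₂) := by
      rw [Subgroup.mem_centralizer_iff]
      rintro _ ⟨a, rfl⟩
      have h := hg a
      calc φ a * g = g * φ a * g⁻¹ * g := by rw [h]
        _ = g * φ a := by rw [inv_mul_cancel_right]
    rw [hcent, Subgroup.mem_bot] at hgz
    subst hgz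
    apply Iso.ext
    apply NatTrans.ext
    funext X
    apply ObjectProperty.hom_ext
    apply Action.Hom.ext
    refine ConcreteCategory.hom_ext _ _ fun x => ?_
    rw [hact X x, map_one]
    rfl

end Literature.AnabelianGeometry.SemiGraphs
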